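import Summits.MatrixMultiplication.MatrixMultiplication.Theorems.AbelianSTPPCensusTAStatEDefs

/-!
# T_A static certificate, range `6380 … 6779` (t*-indexed linear checker with the k-member tree at `τ = 2371/1000`): kernel evaluation, the shape checks of the tree-heavy volume `3927` on its order sub-ranges (one theorem per (volume, sub-range): bounded kernel memory)

Cell mm-stpp (rung F-M1), tier T_A = «beat `2.371`, the record exponent (ADVXXZ'25 / DEK+26 rounded)»; checker in `AbelianSTPPCensusTAStatEDefs.lean`, table and bucket lists in `AbelianSTPPCensusTAStatEData.lean`
(pattern: theory g12's `AbelianSTPPCensusTAStatDDom*/DCk*.lean`).  `decide` with kernel reduction (standard axioms; no `native_decide`), `Elab.async false`;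
consumed by `TAStatE.checkV_sound` / `TAStatE.domV_sound` / `TAStatE.m2V_sound` in the leaf `AbelianSTPPCensusLeafTA6779Closed.lean`.
WHAT THIS IS NOT: arithmetic on shape lists only; no statement about STPP families or `ω`.
-/

set_option linter.dupNamespace false
set_option autoImplicit false
set_option Elab.async false

namespace Summit.MatrixMultiplication.MatrixMultiplication.Theorems.TAStatE

set_option maxHeartbeats 0 in
/-- Heavy volume `3927` (37192 tree nodes over all orders), orders `6380 … 6519`: every sorted candidate shape passes `checkShape 6380 6519`. [original] -/
theorem ck3927r0 : TAStatE.checkV 6380 6519 1 3927 = true := by decide +kernel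

set_option maxHeartbeats 0 in
/-- Heavy volume `3927` (37192 tree nodes over all orders), orders `6520 … 6659`: every sorted candidate shape passes `checkShape 6520 6659`. [original] -/
theorem ck3927r1 : TAStatE.checkV 6520 6659 1 3927 = true := by decide +kernel

set_option maxHeartbeats 0 in
/-- Heavy volume `3927` (37192 tree nodes over all orders), orders `6660 … 6718`: every sorted candidate shape passes `checkShape 6660 6718`. [original] -/
theorem ck3927r2 : TAStatE.checkV 6660 6718 1 3927 = true := by decide +kernel

set_option maxHeartbeats 0 in
/-- Heavy volume `3927` (37192 tree nodes over all orders), orders `6719 … 6779`: every sorted candidate shape passes `checkShape 6719 6779`. [original] -/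
theorem ck3927r3 : TAStatE.checkV 6719 6779 1 3927 = true := by decide +kernel

end Summit.MatrixMultiplication.MatrixMultiplication.Theorems.TAStatE
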